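import Literature.Probability.LatticeModels.KCSignConditionScaleChain
import Literature.Probability.LatticeModels.KCFrameCoords
import HarnessLib

/-!
# The sign-condition argument at one mesh: the flat piece and its half-boxes

Topic `Literature/Probability/LatticeModels`. Continuation of `KCSignConditionScale.lean` and
`KCSignConditionScaleChain.lean`: the lattice flat piece of the contour of a configuration at
mesh `δ` in an arbitrary lattice orientation `km` — the row plaquettes `zm + t e_{km+1}`,
`t ≤ h = 64 kH`, whose closed squares meet the flat segment `[q₁, q₂]/δ`, the rectangle of bulk
plaquettes on the seed side (frame coordinates `1 ≤ n ≤ h`, `-(2h+1) ≤ t ≤ 3h+1`), and the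
hypotheses `hFlatRun`, `hMidBox`, `hHfar` of `kc_sign_condition_ineq'` (the far side of the
half-boxes is covered by the chain windows, `KCSignConfig.farside`).

All `[folklore]` glue; no named fact.

## References

* D. Chelkak, S. Smirnov, Invent. Math. 189 (2012) = arXiv:0910.2045, proof of Thm. 6.1 (the
  `μ × ¼μ` rectangle and the fixed middle piece of `C^δ`). [ChelkakSmirnov2012Ising]
-/

noncomputable section

open Set Metric

namespace Literature.Probability.LatticeModels

open Site WeakBeurling

/-! ### Frame steps and frame rectangles -/

/-- The frame components of the four unit steps. [folklore] -/
theorem nStep_tStep_values (k : Fin 4) :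
    (nStep k k = 1 ∧ tStep k k = 0) ∧ (nStep k (k + 1) = 0 ∧ tStep k (k + 1) = 1) ∧
      (nStep k (k + 2) = -1 ∧ tStep k (k + 2) = 0) ∧ (nStep k (k + 3) = 0 ∧ tStep k (k + 3) = -1) := by
  fin_cases k <;> simp [nStep, tStep]

/-- Frame coordinates after `i` unit steps. [folklore] -/
theorem frame_add_nsmul_cornerUnit (k : Fin 4) (z₀ z : Site 2) (m : Fin 4) (i : ℕ) :
    nCoord k z₀ (z + i • cornerUnit m) = nCoord k z₀ z + i * nStep k m ∧
      tCoord k z₀ (z + i • cornerUnit m) = tCoord k z₀ z + i * tStep k m := by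
  induction i with
  | zero => simp
  | succ i ih =>
    rw [succ_nsmul, ← add_assoc, nCoord_add_cornerUnit, tCoord_add_cornerUnit, ih.1, ih.2]
    push_cast
    constructor <;> ring

/-- Change of base point of the frame coordinates. [folklore] -/
theorem frame_change_base (k : Fin 4) (z₀ z₁ z : Site 2) :
    nCoord k z₁ z = nCoord k z₀ z - nCoord k z₀ z₁ ∧ tCoord k z₁ z = tCoord k z₀ z - tCoord k z₀ z₁ := by
  simp only [nCoord, tCoord]; constructor <;> ring

/-- The frame rectangle `{n₁ ≤ n ≤ n₂, t₁ ≤ t ≤ t₂}` about `z₀`. [folklore] -/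
def frameRect (k : Fin 4) (z₀ : Site 2) (n₁ n₂ t₁ t₂ : ℤ) : Set (Site 2) :=
  {z | n₁ ≤ nCoord k z₀ z ∧ nCoord k z₀ z ≤ n₂ ∧ t₁ ≤ tCoord k z₀ z ∧ tCoord k z₀ z ≤ t₂}

/-- One leg of a walk inside a frame rectangle: `d` steps in direction `m` from a reachable
plaquette `g`, all intermediate plaquettes staying in the rectangle. [folklore] -/
theorem frameRect_leg {Λ : Finset (Site 2)} {avoid : Set (Site 2)} {f₀ : Site 2} (h₀ : f₀ ∉ avoid)
    (k : Fin 4) (z₀ : Site 2) {n₁ n₂ t₁ t₂ : ℤ}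
    (hall : ∀ f ∈ frameRect k z₀ n₁ n₂ t₁ t₂, ∀ j : Fin 4, SideTouch Λ f j)
    (hav : ∀ f ∈ frameRect k z₀ n₁ n₂ t₁ t₂, f ∉ avoid)
    {g : Site 2} (hgD : g ∈ touchReach Λ avoid f₀) (m : Fin 4) (d : ℕ)
    (hstay : ∀ i : ℕ, i ≤ d → n₁ ≤ nCoord k z₀ g + i * nStep k m ∧ nCoord k z₀ g + i * nStep k m ≤ n₂ ∧
      t₁ ≤ tCoord k z₀ g + i * tStep k m ∧ tCoord k z₀ g + i * tStep k m ≤ t₂) :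
    g + d • cornerUnit m ∈ touchReach Λ avoid f₀ := by
  refine add_nsmul_cornerUnit_mem_touchReach h₀ hall hav hgD m d fun i hi => ?_
  have h := frame_add_nsmul_cornerUnit k z₀ g m i
  show n₁ ≤ nCoord k z₀ (g + i • cornerUnit m) ∧ nCoord k z₀ (g + i • cornerUnit m) ≤ n₂ ∧
    t₁ ≤ tCoord k z₀ (g + i • cornerUnit m) ∧ tCoord k z₀ (g + i • cornerUnit m) ≤ t₂
  rw [h.1, h.2]
  exact hstay i hi

/-- **Frame rectangles of all-touching plaquettes off `avoid` are reachable as soon as one of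
their plaquettes is.** [folklore] -/
theorem frameRect_subset_touchReach {Λ : Finset (Site 2)} {avoid : Set (Site 2)} {f₀ : Site 2} (h₀ : f₀ ∉ avoid)
    (k : Fin 4) (z₀ : Site 2) {n₁ n₂ t₁ t₂ : ℤ}
    (hall : ∀ f ∈ frameRect k z₀ n₁ n₂ t₁ t₂, ∀ j : Fin 4, SideTouch Λ f j)
    (hav : ∀ f ∈ frameRect k z₀ n₁ n₂ t₁ t₂, f ∉ avoid)
    {c' : Site 2} (hc' : c' ∈ frameRect k z₀ n₁ n₂ t₁ t₂) (hc'D : c' ∈ touchReach Λ avoid f₀) :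
    ∀ f ∈ frameRect k z₀ n₁ n₂ t₁ t₂, f ∈ touchReach Λ avoid f₀ := by
  intro f hf
  obtain ⟨hc1, hc2, hc3, hc4⟩ := hc'
  obtain ⟨hf1, hf2, hf3, hf4⟩ := hf
  obtain ⟨⟨hkk_n, hkk_t⟩, ⟨hk1_n, hk1_t⟩, ⟨hk2_n, hk2_t⟩, ⟨hk3_n, hk3_t⟩⟩ := nStep_tStep_values k
  have hfin : ∀ g' : Site 2, nCoord k z₀ g' = nCoord k z₀ f → tCoord k z₀ g' = tCoord k z₀ f → g' = f := by
    intro g' h1 h2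
    rw [eq_of_frame k z₀ g', eq_of_frame k z₀ f, h1, h2]
  -- tangential leg: reach `g` with `n g = n c'`, `t g = t f`
  obtain ⟨g, hgn, hgt, hgD⟩ : ∃ g, nCoord k z₀ g = nCoord k z₀ c' ∧ tCoord k z₀ g = tCoord k z₀ f ∧ g ∈ touchReach Λ avoid f₀ := by
    rcases le_or_gt (tCoord k z₀ c') (tCoord k z₀ f) with hle | hlt
    · obtain ⟨d, hd⟩ := Int.eq_ofNat_of_zero_le (sub_nonneg.2 hle)
      refine ⟨c' + d • cornerUnit (k + 1), ?_, ?_, frameRect_leg h₀ k z₀ hall hav hc'D (k + 1) d fun i hi => ?_⟩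
      · rw [(frame_add_nsmul_cornerUnit k z₀ c' (k + 1) d).1, hk1_n]; ring
      · rw [(frame_add_nsmul_cornerUnit k z₀ c' (k + 1) d).2, hk1_t]; omega
      · rw [hk1_n, hk1_t]
        have hi' : (i : ℤ) ≤ d := by exact_mod_cast hi
        refine ⟨?_, ?_, ?_, ?_⟩ <;> nlinarith
    · obtain ⟨d, hd⟩ := Int.eq_ofNat_of_zero_le (sub_nonneg.2 hlt.le)
      refine ⟨c' + d • cornerUnit (k + 3), ?_, ?_, frameRect_leg h₀ k z₀ hall hav hc'D (k + 3) d fun i hi => ?_⟩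
      · rw [(frame_add_nsmul_cornerUnit k z₀ c' (k + 3) d).1, hk3_n]; ring
      · rw [(frame_add_nsmul_cornerUnit k z₀ c' (k + 3) d).2, hk3_t]; omega
      · rw [hk3_n, hk3_t]
        have hi' : (i : ℤ) ≤ d := by exact_mod_cast hi
        refine ⟨?_, ?_, ?_, ?_⟩ <;> nlinarith
  -- normal leg: from `g` to `f`
  rcases le_or_gt (nCoord k z₀ g) (nCoord k z₀ f) with hle | hlt
  · obtain ⟨d, hd⟩ := Int.eq_ofNat_of_zero_le (sub_nonneg.2 hle)
    have key := frameRect_leg h₀ k z₀ hall hav hgD k d fun i hi => by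
      rw [hkk_n, hkk_t]
      have hi' : (i : ℤ) ≤ d := by exact_mod_cast hi
      refine ⟨?_, ?_, ?_, ?_⟩ <;> nlinarith
    rwa [hfin (g + d • cornerUnit k) ?_ ?_] at key
    · rw [(frame_add_nsmul_cornerUnit k z₀ g k d).1, hkk_n]; omega
    · rw [(frame_add_nsmul_cornerUnit k z₀ g k d).2, hkk_t, hgt]; ring
  · obtain ⟨d, hd⟩ := Int.eq_ofNat_of_zero_le (sub_nonneg.2 hlt.le)
    have key := frameRect_leg h₀ k z₀ hall hav hgD (k + 2) d fun i hi => by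
      rw [hk2_n, hk2_t]
      have hi' : (i : ℤ) ≤ d := by exact_mod_cast hi
      refine ⟨?_, ?_, ?_, ?_⟩ <;> nlinarith
    rwa [hfin (g + d • cornerUnit (k + 2)) ?_ ?_] at key
    · rw [(frame_add_nsmul_cornerUnit k z₀ g (k + 2) d).1, hk2_n]; omega
    · rw [(frame_add_nsmul_cornerUnit k z₀ g (k + 2) d).2, hk2_t, hgt]; ring

/-! ### The lattice flat piece of a configuration -/

namespace KCSignConfig

variable {Ω G Bad : Set ℂ} (cfg : KCSignConfig Ω G Bad)

/-- The half-box height `h = 64 kH`. [folklore] -/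
def hH (δ : ℝ) : ℕ := 64 * cfg.kH δ

/-- The normal coordinate of the flat segment (lattice units). [folklore] -/
def nuF (δ : ℝ) : ℝ := dirCoord cfg.km (cfg.pmid / δ)

/-- The tangential coordinate of the midpoint of the flat segment (lattice units). [folklore] -/
def tauP (δ : ℝ) : ℝ := dirCoord (cfg.km + 1) (cfg.pmid / δ)

/-- The integer normal index of the row of the flat piece, `A = ⌊nuF⌋`. [folklore] -/
def Arow (δ : ℝ) : ℤ := ⌊cfg.nuF δ⌋

/-- The integer tangential index of the start of the flat run, `B = ⌊tauP - h/2⌋`. [folklore] -/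
def Bcol (δ : ℝ) : ℤ := ⌊cfg.tauP δ - (cfg.hH δ : ℝ) / 2⌋

/-- The half-diagonal offset `½ (1 + i)` from a site to the centre of its plaquette. [folklore] -/
def halfDiag : ℂ := ((1 / 2 : ℝ) : ℂ) * (1 + Complex.I)

/-- The site coordinate producing centre coordinate `X + ½` along direction `k`. [folklore] -/
def siteIndex (k : Fin 4) (X : ℤ) : ℤ := if dirCoord k halfDiag = 1 / 2 then X else X + 1

/-- `siteIndex k X + dirCoord k halfDiag = X + ½`. [folklore] -/
theorem siteIndex_add (k : Fin 4) (X : ℤ) : (siteIndex k X : ℝ) + dirCoord k halfDiag = X + 1 / 2 := by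
  have hd : dirCoord k halfDiag = 1 / 2 ∨ dirCoord k halfDiag = -(1 / 2) := dirCoord_half_diag k
  unfold siteIndex
  rcases hd with h | h
  · rw [if_pos h, h]
  · have hne : dirCoord k halfDiag ≠ 1 / 2 := by rw [h]; norm_num
    rw [if_neg hne, h]; push_cast; ring

/-- **The first plaquette of the lattice flat piece**: its centre has frame coordinates
`(A + ½, B + ½)`. [folklore] -/
def zm (δ : ℝ) : Site 2 :=
  siteIndex cfg.km (cfg.Arow δ) • cornerUnit cfg.km + siteIndex (cfg.km + 1) (cfg.Bcol δ) • cornerUnit (cfg.km + 1)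

/-- The plaquettes of the lattice flat piece, `zm + t e_{km+1}`. [folklore] -/
def zmt (δ : ℝ) (t : ℤ) : Site 2 := runPt (cfg.zm δ) (cfg.km + 1) t

/-- The centre of `zm` in frame coordinates. [folklore] -/
theorem dirCoord_plaqCentre_zm (δ : ℝ) :
    dirCoord cfg.km (plaqCentre (cfg.zm δ)) = cfg.Arow δ + 1 / 2 ∧
      dirCoord (cfg.km + 1) (plaqCentre (cfg.zm δ)) = cfg.Bcol δ + 1 / 2 := by
  have hc : plaqCentre (cfg.zm δ) = toComplex (cfg.zm δ) + halfDiag := by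
    rw [toComplex_eq_plaqCentre_sub, halfDiag]; ring
  rw [hc, dirCoord_add, dirCoord_add, zm, (dirCoord_toComplex_frame _ _ _).1, (dirCoord_toComplex_frame _ _ _).2]
  exact ⟨siteIndex_add _ _, siteIndex_add _ _⟩

/-- The centres of the flat-piece plaquettes in frame coordinates. [folklore] -/
theorem dirCoord_plaqCentre_zmt (δ : ℝ) (t : ℤ) :
    dirCoord cfg.km (plaqCentre (cfg.zmt δ t)) = cfg.Arow δ + 1 / 2 ∧
      dirCoord (cfg.km + 1) (plaqCentre (cfg.zmt δ t)) = cfg.Bcol δ + 1 / 2 + t := by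
  obtain ⟨h1, h2⟩ := cfg.dirCoord_plaqCentre_zm δ
  rw [zmt, plaqCentre_runPt, dirCoord_add, dirCoord_add, h1, h2]
  have e1 : dirCoord cfg.km ((t : ℂ) * dirVec (cfg.km + 1)) = 0 := by exact_mod_cast dirCoord_mul_dirVec_succ cfg.km t
  have e2 : dirCoord (cfg.km + 1) ((t : ℂ) * dirVec (cfg.km + 1)) = t := by exact_mod_cast dirCoord_succ_mul_dirVec_succ cfg.km t
  rw [e1, e2]; exact ⟨by ring, rfl⟩

/-- Frame coordinates of `zmt t` relative to `zm`: `(0, t)`. [folklore] -/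
theorem frame_zmt (δ : ℝ) (t : ℤ) : nCoord cfg.km (cfg.zm δ) (cfg.zmt δ t) = 0 ∧ tCoord cfg.km (cfg.zm δ) (cfg.zmt δ t) = t := by
  have h1 := nCoord_cast cfg.km (cfg.zm δ) (cfg.zmt δ t)
  have h2 := tCoord_cast cfg.km (cfg.zm δ) (cfg.zmt δ t)
  have e : toComplex (cfg.zmt δ t) - toComplex (cfg.zm δ) = plaqCentre (cfg.zmt δ t) - plaqCentre (cfg.zm δ) := by
    rw [toComplex_eq_plaqCentre_sub, toComplex_eq_plaqCentre_sub]; ring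
  rw [e, dirCoord_sub] at h1 h2
  obtain ⟨a1, a2⟩ := cfg.dirCoord_plaqCentre_zmt δ t
  obtain ⟨b1, b2⟩ := cfg.dirCoord_plaqCentre_zm δ
  rw [a1, b1] at h1; rw [a2, b2] at h2
  constructor
  · have : (nCoord cfg.km (cfg.zm δ) (cfg.zmt δ t) : ℝ) = 0 := by rw [h1]; ring
    exact_mod_cast this
  · have : (tCoord cfg.km (cfg.zm δ) (cfg.zmt δ t) : ℝ) = t := by rw [h2]; ring
    exact_mod_cast this

/-- Frame coordinates (real, relative to `pmid/δ`) of the centre of a plaquette with integer frame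
coordinates `(n, τ)` relative to `zm`. [folklore] -/
theorem dirCoord_plaqCentre_of_frame (δ : ℝ) (z : Site 2) :
    dirCoord cfg.km (plaqCentre z - cfg.pmid / δ) = nCoord cfg.km (cfg.zm δ) z + (cfg.Arow δ + 1 / 2 - cfg.nuF δ) ∧
      dirCoord (cfg.km + 1) (plaqCentre z - cfg.pmid / δ) = tCoord cfg.km (cfg.zm δ) z + (cfg.Bcol δ + 1 / 2 - cfg.tauP δ) := by
  have h1 := nCoord_cast cfg.km (cfg.zm δ) z
  have h2 := tCoord_cast cfg.km (cfg.zm δ) z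
  have e : toComplex z - toComplex (cfg.zm δ) = plaqCentre z - plaqCentre (cfg.zm δ) := by
    rw [toComplex_eq_plaqCentre_sub, toComplex_eq_plaqCentre_sub]; ring
  rw [e, dirCoord_sub] at h1 h2
  obtain ⟨b1, b2⟩ := cfg.dirCoord_plaqCentre_zm δ
  rw [dirCoord_sub, dirCoord_sub, nuF, tauP]
  constructor <;> linarith

/-- `A + ½ - nuF ∈ (-½, ½]` and `B + ½ - tauP ∈ (-h/2 - ½, -h/2 + ½]`. [folklore] -/
theorem Arow_Bcol_bounds (δ : ℝ) :
    (-(1 / 2 : ℝ) < cfg.Arow δ + 1 / 2 - cfg.nuF δ ∧ cfg.Arow δ + 1 / 2 - cfg.nuF δ ≤ 1 / 2) ∧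
      (-(cfg.hH δ : ℝ) / 2 - 1 / 2 < cfg.Bcol δ + 1 / 2 - cfg.tauP δ ∧ cfg.Bcol δ + 1 / 2 - cfg.tauP δ ≤ -(cfg.hH δ : ℝ) / 2 + 1 / 2) := by
  have a1 := Int.floor_le (cfg.nuF δ); have a2 := Int.lt_floor_add_one (cfg.nuF δ)
  have b1 := Int.floor_le (cfg.tauP δ - (cfg.hH δ : ℝ) / 2); have b2 := Int.lt_floor_add_one (cfg.tauP δ - (cfg.hH δ : ℝ) / 2)
  rw [Arow, Bcol]
  refine ⟨⟨by linarith, by linarith⟩, by linarith, by linarith⟩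

/-- `1 ≤ h`. [folklore] -/
theorem hH_cast (δ : ℝ) : (cfg.hH δ : ℝ) = 64 * cfg.kH δ := by simp [hH]

/-- Integer coordinates of sites are differences of plaquette centres. [folklore] -/
theorem site_sub_eq_centre_sub (z c : Site 2) :
    ((z 0 - c 0 : ℤ) : ℝ) = (plaqCentre z - plaqCentre c).re ∧ ((z 1 - c 1 : ℤ) : ℝ) = (plaqCentre z - plaqCentre c).im := by
  constructor <;> simp [plaqCentre]

/-- Points of the flat segment have normal coordinate `0`. [folklore] -/
theorem dirCoord_eq_zero_of_mem_flat {x : ℂ} (hx : x ∈ segment ℝ cfg.q₁ cfg.q₂) : dirCoord cfg.km (x - cfg.pmid) = 0 := by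
  rw [segment_eq_image'] at hx
  obtain ⟨θ, -, rfl⟩ := hx
  simp only [q₁, q₂]
  have : cfg.pmid - ((cfg.len / 2 : ℝ) : ℂ) * dirVec (cfg.km + 1) +
      θ • (cfg.pmid + ((cfg.len / 2 : ℝ) : ℂ) * dirVec (cfg.km + 1) - (cfg.pmid - ((cfg.len / 2 : ℝ) : ℂ) * dirVec (cfg.km + 1))) - cfg.pmid =
      ((θ * cfg.len - cfg.len / 2 : ℝ) : ℂ) * dirVec (cfg.km + 1) := by
    rw [Complex.real_smul]; push_cast; ring
  rw [this, dirCoord_mul_dirVec_succ]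

/-- Frame coordinates of `zm + a e_{km} + b e_{km+1}`. [folklore] -/
theorem frame_of_add (δ : ℝ) (a b : ℤ) :
    nCoord cfg.km (cfg.zm δ) (cfg.zm δ + a • cornerUnit cfg.km + b • cornerUnit (cfg.km + 1)) = a ∧
      tCoord cfg.km (cfg.zm δ) (cfg.zm δ + a • cornerUnit cfg.km + b • cornerUnit (cfg.km + 1)) = b := by
  obtain ⟨hs0, hs1⟩ := cornerUnit_succ_apply cfg.km
  rcases cornerUnit_apply_cases cfg.km with ⟨h0, h1⟩ | ⟨h0, h1⟩ | ⟨h0, h1⟩ | ⟨h0, h1⟩ <;>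
    simp [nCoord, tCoord, Pi.add_apply, hs0, hs1, h0, h1]

namespace ScaleHyp

variable {cfg} {δ μ : ℝ} {Λ : Finset (Site 2)} (H : ScaleHyp cfg δ Λ μ)
include H

/-- `64 (κ/δ - 1) < h ≤ 64 κ/δ` and `1 ≤ h`. [folklore] -/
theorem hH_bounds : 64 * (cfg.κ / δ - 1) < cfg.hH δ ∧ (cfg.hH δ : ℝ) ≤ 64 * (cfg.κ / δ) ∧ 1 ≤ cfg.hH δ := by
  have hk := H.kH_bounds
  have hpos := H.kH_pos
  rw [hH_cast]
  refine ⟨by linarith, by linarith, ?_⟩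
  unfold hH; omega

/-- Frame coordinates scale: `dirCoord k (δ w - pmid) = δ · dirCoord k (w - pmid/δ)`. [folklore] -/
theorem dirCoord_scale (k : Fin 4) (w : ℂ) : dirCoord k ((δ : ℂ) * w - cfg.pmid) = δ * dirCoord k (w - cfg.pmid / δ) := by
  have hδ' : (δ : ℂ) ≠ 0 := Complex.ofReal_ne_zero.2 H.δ_pos.ne'
  have : (δ : ℂ) * w - cfg.pmid = ((δ : ℝ) : ℂ) * (w - cfg.pmid / δ) := by rw [mul_sub, mul_div_cancel₀ _ hδ']
  rw [this, dirCoord_real_mul]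

/-- A point whose frame coordinates relative to `pmid/δ` are at most `2ℓ/δ` scales into the clear box. [folklore] -/
theorem scale_mem_clearBox {w : ℂ} (hn : |dirCoord cfg.km (w - cfg.pmid / δ)| ≤ 2 * cfg.ℓ / δ)
    (ht : |dirCoord (cfg.km + 1) (w - cfg.pmid / δ)| ≤ 2 * cfg.ℓ / δ) :
    |dirCoord cfg.km ((δ : ℂ) * w - cfg.pmid)| ≤ 2 * cfg.ℓ ∧ |dirCoord (cfg.km + 1) ((δ : ℂ) * w - cfg.pmid)| ≤ 2 * cfg.ℓ := by
  have hδ := H.δ_pos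
  rw [H.dirCoord_scale, H.dirCoord_scale, abs_mul, abs_mul, abs_of_pos hδ]
  rw [le_div_iff₀ hδ] at hn ht
  constructor <;> nlinarith

/-- The run of the flat piece fits in the flat segment: `δ (h + 1) ≤ len`, and the clear box is
large: `δ (6 h + 6) ≤ 2 ℓ`. [folklore] -/
theorem hH_fits : δ * ((cfg.hH δ : ℝ) + 1) ≤ cfg.len / 2 ∧ δ * (6 * (cfg.hH δ : ℝ) + 6) ≤ 2 * cfg.ℓ := by
  have hδ := H.δ_pos
  obtain ⟨-, h2, -⟩ := H.hH_bounds
  have hκℓ := cfg.κ_le; have hℓ := cfg.ℓ_le; have hδκ := H.δ_le_κ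
  have hhδ : δ * (cfg.hH δ : ℝ) ≤ 64 * cfg.κ := by
    calc δ * (cfg.hH δ : ℝ) ≤ δ * (64 * (cfg.κ / δ)) := mul_le_mul_of_nonneg_left h2 hδ.le
      _ = 64 * cfg.κ := by field_simp
  constructor <;> nlinarith

/-- **The witness point of a flat-piece plaquette**: a point of its closed square on the scaled
flat segment, within `½` of its centre, which is not a frozen end. [folklore] -/
theorem exists_flat_witness {t : ℕ} (ht : t ≤ cfg.hH δ) :
    ∃ P : ℂ, P ∈ plaqClosedSq (cfg.zmt δ t) ∧ P ∈ segment ℝ (cfg.q₁ / δ) (cfg.q₂ / δ) ∧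
      dist (plaqCentre (cfg.zmt δ t)) P ≤ 1 / 2 ∧ ∀ e, P ≠ toComplex (cfg.aEnd δ Λ e) := by
  have hδ := H.δ_pos
  have hδ' : (δ : ℂ) ≠ 0 := Complex.ofReal_ne_zero.2 hδ.ne'
  obtain ⟨⟨hA1, hA2⟩, hB1, hB2⟩ := cfg.Arow_Bcol_bounds δ
  obtain ⟨hfit, -⟩ := H.hH_fits
  have ht' : (t : ℝ) ≤ cfg.hH δ := by exact_mod_cast ht
  -- the tangential offset of the witness point from `pmid/δ`
  set s : ℝ := cfg.Bcol δ + 1 / 2 + t - cfg.tauP δ with hs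
  have hs1 : |s| ≤ (cfg.hH δ : ℝ) / 2 + 1 / 2 := by rw [abs_le]; constructor <;> linarith
  have hsabs : |s| ≤ cfg.len / 2 / δ := by
    rw [le_div_iff₀ hδ]
    nlinarith [abs_nonneg s]
  set P : ℂ := cfg.pmid / δ + (s : ℂ) * dirVec (cfg.km + 1) with hP
  have hPn : dirCoord cfg.km (P - plaqCentre (cfg.zmt δ t)) = cfg.nuF δ - (cfg.Arow δ + 1 / 2) := by
    rw [dirCoord_sub, hP, dirCoord_add, dirCoord_mul_dirVec_succ, (cfg.dirCoord_plaqCentre_zmt δ t).1, nuF]; ring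
  have hPt : dirCoord (cfg.km + 1) (P - plaqCentre (cfg.zmt δ t)) = 0 := by
    rw [dirCoord_sub, hP, dirCoord_add, dirCoord_succ_mul_dirVec_succ, (cfg.dirCoord_plaqCentre_zmt δ t).2, hs, tauP]
    push_cast; ring
  refine ⟨P, ?_, ?_, ?_, ?_⟩
  · -- (a) the witness lies in the closed square
    rw [mem_plaqClosedSq_iff_dirCoord cfg.km, hPn, hPt]
    refine ⟨?_, by norm_num⟩
    rw [abs_le]; constructor <;> linarith
  · -- (b) the witness lies on the scaled flat segment
    have ha : 0 < cfg.len / 2 / δ := div_pos (half_pos cfg.len_pos) hδ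
    rw [segment_eq_image']
    refine ⟨(s + cfg.len / 2 / δ) / (2 * (cfg.len / 2 / δ)), ⟨?_, ?_⟩, ?_⟩
    · apply div_nonneg <;> [rw [abs_le] at hsabs; skip] <;> linarith
    · rw [div_le_one (by positivity)]; rw [abs_le] at hsabs; linarith
    · simp only [q₁, q₂, hP]
      have hlen : (cfg.len : ℂ) ≠ 0 := Complex.ofReal_ne_zero.2 cfg.len_pos.ne'
      rw [Complex.real_smul]
      push_cast
      field_simp
      ring
  · -- (c) the witness is within `½` of the centre
    rw [dist_comm, dist_eq_norm]
    refine (norm_le_abs_dirCoord_add cfg.km _).trans ?_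
    rw [hPn, hPt, abs_zero, add_zero, abs_le]
    constructor <;> linarith
  · -- (d) the witness is not a frozen end (the flat segment lies in the free bulk)
    intro e hPe
    apply (cfg.aEnd_spec δ Λ e).1
    apply H.bulk
    have hPseg : P ∈ segment ℝ (cfg.q₁ / δ) (cfg.q₂ / δ) := by
      -- re-derive (b) in set form from `hPe`-independent data: use the image description again
      have ha : 0 < cfg.len / 2 / δ := div_pos (half_pos cfg.len_pos) hδ
      rw [segment_eq_image']
      refine ⟨(s + cfg.len / 2 / δ) / (2 * (cfg.len / 2 / δ)), ⟨?_, ?_⟩, ?_⟩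
      · apply div_nonneg <;> [rw [abs_le] at hsabs; skip] <;> linarith
      · rw [div_le_one (by positivity)]; rw [abs_le] at hsabs; linarith
      · simp only [q₁, q₂, hP]
        have hlen : (cfg.len : ℂ) ≠ 0 := Complex.ofReal_ne_zero.2 cfg.len_pos.ne'
        rw [Complex.real_smul]
        push_cast
        field_simp
        ring
    have hmid : (δ : ℂ) * P ∈ cfg.Mset := H.scale_mem_Mset_of_mem_midSet (Or.inl (Or.inr hPseg))
    rw [hPe] at hmid
    refine Or.inl (Or.inr (mem_cthickening_of_dist_le _ _ _ _ hmid ?_))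
    rw [dist_self]; linarith [cfg.rM_pos]

/-- **The plaquettes of the lattice flat piece are avoided.** [folklore] -/
theorem zmt_mem_CsetL {t : ℕ} (ht : t ≤ cfg.hH δ) : cfg.zmt δ t ∈ cfg.CsetL δ Λ μ := by
  obtain ⟨P, hPsq, hPseg, -, hPa⟩ := H.exists_flat_witness ht
  refine ⟨P, hPsq, Or.inl (Or.inr (Or.inl (Or.inr hPseg))), ?_⟩
  simp only [Set.mem_insert_iff, Set.mem_singleton_iff, not_or]
  exact ⟨hPa 0, hPa 1⟩

/-- **The flat predicate**: the plaquettes `zmt t`, `t ≤ h`. [folklore] -/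
def Flat (_H : ScaleHyp cfg δ Λ μ) (f : Site 2) : Prop := ∃ t : ℕ, t ≤ cfg.hH δ ∧ f = cfg.zmt δ t

/-- Flat plaquettes have their scaled centre in `Kflat` (within `δ/2 ≤ rM` of the flat segment). [folklore] -/
theorem scale_centre_mem_Kflat_of_flat {f : Site 2} (hf : H.Flat f) : (δ : ℂ) * plaqCentre f ∈ cfg.Kflat := by
  obtain ⟨t, ht, rfl⟩ := hf
  obtain ⟨P, -, hPseg, hPd, -⟩ := H.exists_flat_witness ht
  have hδ := H.δ_pos
  have hδ' : (δ : ℂ) ≠ 0 := Complex.ofReal_ne_zero.2 hδ.ne'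
  have hPF : (δ : ℂ) * P ∈ segment ℝ cfg.q₁ cfg.q₂ := by
    rw [segment_eq_image'] at hPseg ⊢
    obtain ⟨θ, hθ, rfl⟩ := hPseg
    refine ⟨θ, hθ, ?_⟩
    show cfg.q₁ + θ • (cfg.q₂ - cfg.q₁) = δ * (cfg.q₁ / δ + θ • (cfg.q₂ / δ - cfg.q₁ / δ))
    rw [Complex.real_smul, Complex.real_smul, mul_add, mul_div_cancel₀ _ hδ', ← sub_div, mul_left_comm, mul_div_cancel₀ _ hδ']
  refine mem_cthickening_of_dist_le _ _ _ _ hPF ?_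
  rw [H.dist_scale]
  calc δ * dist (plaqCentre (cfg.zmt δ t)) P ≤ δ * (1 / 2) := mul_le_mul_of_nonneg_left hPd hδ.le
    _ ≤ cfg.rM := by linarith [H.δ_le_rM, cfg.rM_pos]

/-- Flat plaquettes are `Mid`. [folklore] -/
theorem mid_of_flat {f : Site 2} (hf : H.Flat f) : H.Mid f := by
  refine Or.inr (cthickening_subset_of_subset _ ?_ (H.scale_centre_mem_Kflat_of_flat hf))
  intro x hx; exact Or.inl (Or.inr hx)

/-! ### The far side is covered by the chain -/

/-- **`hHfar`**: the far side of the half-boxes (frame coordinates `n = h + 1`, `|t| ≤ 3h + 2`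
relative to `zm`) is covered by the start boxes `mB (cH j) kH` of the chain. [folklore] -/
theorem far_mem_mB {z : Site 2} (hn : nCoord cfg.km (cfg.zm δ) z = cfg.hH δ + 1)
    (htc : -(2 * (cfg.hH δ : ℤ) + 1) ≤ tCoord cfg.km (cfg.zm δ) z ∧ tCoord cfg.km (cfg.zm δ) z ≤ 3 * cfg.hH δ + 1) :
    ∃ j, j ≤ cfg.J ∧ z ∈ mB (cfg.cH δ j) (cfg.kH δ) := by
  have hδ := H.δ_pos
  have hδ' : (δ : ℂ) ≠ 0 := Complex.ofReal_ne_zero.2 hδ.ne'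
  obtain ⟨⟨hA1, hA2⟩, hB1, hB2⟩ := cfg.Arow_Bcol_bounds δ
  obtain ⟨hh1, hh2, -⟩ := H.hH_bounds
  have hk := H.kH_bounds
  have h100 := H.hundred_le_κ_div
  obtain ⟨hcn, hct⟩ := cfg.dirCoord_plaqCentre_of_frame δ z
  have hn' : (nCoord cfg.km (cfg.zm δ) z : ℝ) = cfg.hH δ + 1 := by exact_mod_cast hn
  have htc1 : (-(2 * (cfg.hH δ : ℝ) + 1)) ≤ tCoord cfg.km (cfg.zm δ) z := by exact_mod_cast htc.1
  have htc2 : (tCoord cfg.km (cfg.zm δ) z : ℝ) ≤ 3 * cfg.hH δ + 1 := by exact_mod_cast htc.2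
  -- the continuum tangential offset `s`
  set s : ℝ := δ * dirCoord (cfg.km + 1) (plaqCentre z - cfg.pmid / δ) with hs
  have hsabs : |s| ≤ 200 * cfg.κ := by
    rw [hs, hct, abs_le]
    have hhδ : δ * (cfg.hH δ : ℝ) ≤ 64 * cfg.κ := by
      calc δ * (cfg.hH δ : ℝ) ≤ δ * (64 * (cfg.κ / δ)) := mul_le_mul_of_nonneg_left hh2 hδ.le
        _ = 64 * cfg.κ := by field_simp
    have hδκ := H.δ_le_κ
    constructor <;> nlinarith
  obtain ⟨j, hj, hre, him⟩ := cfg.farside s hsabs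
  refine ⟨j, hj, ?_⟩
  set P : ℂ := cfg.pmid + ((65 * cfg.κ : ℝ) : ℂ) * dirVec cfg.km + (s : ℂ) * dirVec (cfg.km + 1) with hP
  -- frame coordinates of `plaqCentre z - P/δ`: `(h + 1 + (A + ½ - nuF) - 65 κ/δ, 0)`
  have hPn : dirCoord cfg.km (plaqCentre z - P / δ) = (cfg.hH δ + 1) + (cfg.Arow δ + 1 / 2 - cfg.nuF δ) - 65 * cfg.κ / δ := by
    have : plaqCentre z - P / δ = (plaqCentre z - cfg.pmid / δ) - ((65 * cfg.κ / δ : ℝ) : ℂ) * dirVec cfg.km - ((s / δ : ℝ) : ℂ) * dirVec (cfg.km + 1) := by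
      rw [hP]; push_cast; field_simp; ring
    rw [this, dirCoord_sub, dirCoord_sub, hcn, hn', dirCoord_mul_dirVec_self, dirCoord_mul_dirVec_succ]; ring
  have hPt : dirCoord (cfg.km + 1) (plaqCentre z - P / δ) = 0 := by
    have : plaqCentre z - P / δ = (plaqCentre z - cfg.pmid / δ) - ((65 * cfg.κ / δ : ℝ) : ℂ) * dirVec cfg.km - ((s / δ : ℝ) : ℂ) * dirVec (cfg.km + 1) := by
      rw [hP]; push_cast; field_simp; ring
    rw [this, dirCoord_sub, dirCoord_sub, dirCoord_succ_mul_dirVec, dirCoord_succ_mul_dirVec_succ, hs]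
    field_simp; ring
  have h1 : |(plaqCentre z - P / δ).re| ≤ cfg.κ / δ + 66 ∧ |(plaqCentre z - P / δ).im| ≤ cfg.κ / δ + 66 := by
    rw [← abs_dirCoord_le_iff cfg.km, hPn, hPt]
    refine ⟨?_, by rw [abs_zero]; positivity⟩
    rw [abs_le]
    have : 65 * cfg.κ / δ = 65 * (cfg.κ / δ) := by ring
    constructor <;> linarith
  -- `P/δ` versus `w j / δ`, and `w j / δ` versus the centre of `cH j`
  have h2 : |(P / δ - cfg.w j / δ).re| ≤ 10 * cfg.κ / δ ∧ |(P / δ - cfg.w j / δ).im| ≤ 10 * cfg.κ / δ := by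
    rw [← sub_div, Complex.div_ofReal_re, Complex.div_ofReal_im, abs_div, abs_div, abs_of_pos hδ, ← neg_sub, Complex.neg_re,
      Complex.neg_im, abs_neg, abs_neg]
    exact ⟨div_le_div_of_nonneg_right hre hδ.le, div_le_div_of_nonneg_right him hδ.le⟩
  have h3 := abs_sub_le_of_mem_plaqClosedSq (mem_plaqClosedSq_plaqOf (cfg.w j / δ))
  rw [← cH] at h3
  obtain ⟨e0, e1⟩ := site_sub_eq_centre_sub z (cfg.cH δ j)
  have hk12 : cfg.κ / δ + 66 + 10 * cfg.κ / δ + 1 / 2 ≤ 12 * (cfg.kH δ : ℝ) := by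
    have : 10 * cfg.κ / δ = 10 * (cfg.κ / δ) := by ring
    linarith
  simp only [mB, Set.mem_setOf_eq]
  constructor
  · have key : |((z 0 - cfg.cH δ j 0 : ℤ) : ℝ)| ≤ 12 * (cfg.kH δ : ℕ) := by
      rw [e0]
      have : (plaqCentre z - plaqCentre (cfg.cH δ j)).re =
          (plaqCentre z - P / δ).re + (P / δ - cfg.w j / δ).re + -((plaqCentre (cfg.cH δ j)).re - (cfg.w j / ↑δ).re) := by
        simp only [Complex.sub_re]; ring
      rw [this]
      refine (abs_add_three _ _ _).trans ?_
      rw [abs_neg]; linarith [h1.1, h2.1, h3.1]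
    exact_mod_cast key
  · have key : |((z 1 - cfg.cH δ j 1 : ℤ) : ℝ)| ≤ 12 * (cfg.kH δ : ℕ) := by
      rw [e1]
      have : (plaqCentre z - plaqCentre (cfg.cH δ j)).im =
          (plaqCentre z - P / δ).im + (P / δ - cfg.w j / δ).im + -((plaqCentre (cfg.cH δ j)).im - (cfg.w j / ↑δ).im) := by
        simp only [Complex.sub_im]; ring
      rw [this]
      refine (abs_add_three _ _ _).trans ?_
      rw [abs_neg]; linarith [h1.2, h2.2, h3.2]
    exact_mod_cast key

/-- **`hHfar`** in the form consumed by `kc_sign_condition_ineq'` (frame coordinates relative to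
the flat-piece plaquettes `zmt t`). [folklore] -/
theorem hHfar : ∀ t : ℕ, t ≤ cfg.hH δ → ∀ z, nCoord cfg.km (cfg.zmt δ t) z = cfg.hH δ + 1 →
    |tCoord cfg.km (cfg.zmt δ t) z| ≤ 2 * cfg.hH δ + 1 → ∃ j, j ≤ cfg.J ∧ z ∈ mB (cfg.cH δ j) (cfg.kH δ) := by
  intro t ht z hn htc
  obtain ⟨cn, ct⟩ := frame_change_base cfg.km (cfg.zm δ) (cfg.zmt δ t) z
  obtain ⟨zn, zt⟩ := cfg.frame_zmt δ t
  rw [cn, zn, sub_zero] at hn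
  rw [ct, zt, abs_le] at htc
  refine H.far_mem_mB hn ⟨?_, ?_⟩ <;> omega

/-! ### The seed-side rectangle over the flat piece -/

/-- The seed-side rectangle: frame coordinates `1 ≤ n ≤ h`, `-(2h+1) ≤ t ≤ 3h+1` relative to `zm`. [folklore] -/
def seedRect (_H : ScaleHyp cfg δ Λ μ) : Set (Site 2) :=
  frameRect cfg.km (cfg.zm δ) 1 (cfg.hH δ) (-(2 * (cfg.hH δ : ℤ) + 1)) (3 * cfg.hH δ + 1)

/-- Points within `½` (frame coordinates) of the centre of a plaquette of the rows `1 … h + 1`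
over the flat piece scale into the clear box, with positive normal coordinate. [folklore] -/
theorem scale_mem_clearBox_of_near {z : Site 2} (hz1 : 1 ≤ nCoord cfg.km (cfg.zm δ) z) (hz2 : nCoord cfg.km (cfg.zm δ) z ≤ cfg.hH δ + 1)
    (hz3 : -(2 * (cfg.hH δ : ℤ) + 1) ≤ tCoord cfg.km (cfg.zm δ) z) (hz4 : tCoord cfg.km (cfg.zm δ) z ≤ 3 * cfg.hH δ + 1)
    {w : ℂ} (hw : |dirCoord cfg.km (w - plaqCentre z)| ≤ 1 / 2 ∧ |dirCoord (cfg.km + 1) (w - plaqCentre z)| ≤ 1 / 2) :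
    (|dirCoord cfg.km ((δ : ℂ) * w - cfg.pmid)| ≤ 2 * cfg.ℓ ∧ |dirCoord (cfg.km + 1) ((δ : ℂ) * w - cfg.pmid)| ≤ 2 * cfg.ℓ) ∧
      0 < dirCoord cfg.km ((δ : ℂ) * w - cfg.pmid) := by
  have hδ := H.δ_pos
  obtain ⟨⟨hA1, hA2⟩, hB1, hB2⟩ := cfg.Arow_Bcol_bounds δ
  obtain ⟨-, hfit⟩ := H.hH_fits
  obtain ⟨hcn, hct⟩ := cfg.dirCoord_plaqCentre_of_frame δ z
  have hz1' : (1 : ℝ) ≤ nCoord cfg.km (cfg.zm δ) z := by exact_mod_cast hz1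
  have hz2' : (nCoord cfg.km (cfg.zm δ) z : ℝ) ≤ cfg.hH δ + 1 := by exact_mod_cast hz2
  have hz3' : -(2 * (cfg.hH δ : ℝ) + 1) ≤ tCoord cfg.km (cfg.zm δ) z := by exact_mod_cast hz3
  have hz4' : (tCoord cfg.km (cfg.zm δ) z : ℝ) ≤ 3 * cfg.hH δ + 1 := by exact_mod_cast hz4
  have en : dirCoord cfg.km (w - cfg.pmid / δ) = dirCoord cfg.km (w - plaqCentre z) + dirCoord cfg.km (plaqCentre z - cfg.pmid / δ) := by
    rw [← dirCoord_add]; congr 1; ring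
  have et : dirCoord (cfg.km + 1) (w - cfg.pmid / δ) =
      dirCoord (cfg.km + 1) (w - plaqCentre z) + dirCoord (cfg.km + 1) (plaqCentre z - cfg.pmid / δ) := by
    rw [← dirCoord_add]; congr 1; ring
  obtain ⟨hwn, hwt⟩ := hw
  rw [abs_le] at hwn hwt
  obtain ⟨hw1, hw2⟩ := hwn
  obtain ⟨hw3, hw4⟩ := hwt
  refine ⟨H.scale_mem_clearBox ?_ ?_, ?_⟩
  · rw [en, hcn, le_div_iff₀ hδ]
    have : |dirCoord cfg.km (w - plaqCentre z) + ((nCoord cfg.km (cfg.zm δ) z : ℝ) + (cfg.Arow δ + 1 / 2 - cfg.nuF δ))| ≤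
        (cfg.hH δ : ℝ) + 2 := by rw [abs_le]; constructor <;> linarith
    nlinarith [abs_nonneg (dirCoord cfg.km (w - plaqCentre z) + ((nCoord cfg.km (cfg.zm δ) z : ℝ) + (cfg.Arow δ + 1 / 2 - cfg.nuF δ)))]
  · rw [et, hct, le_div_iff₀ hδ]
    have : |dirCoord (cfg.km + 1) (w - plaqCentre z) + ((tCoord cfg.km (cfg.zm δ) z : ℝ) + (cfg.Bcol δ + 1 / 2 - cfg.tauP δ))| ≤
        4 * (cfg.hH δ : ℝ) + 3 := by rw [abs_le]; constructor <;> linarith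
    nlinarith [abs_nonneg (dirCoord (cfg.km + 1) (w - plaqCentre z) + ((tCoord cfg.km (cfg.zm δ) z : ℝ) + (cfg.Bcol δ + 1 / 2 - cfg.tauP δ)))]
  · rw [H.dirCoord_scale, en, hcn]
    apply mul_pos hδ; linarith

/-- **Plaquettes of the rows `1 … h + 1` over the flat piece touch `Λ` across every side.** [folklore] -/
theorem sideTouch_of_rows {z : Site 2} (hz1 : 1 ≤ nCoord cfg.km (cfg.zm δ) z) (hz2 : nCoord cfg.km (cfg.zm δ) z ≤ cfg.hH δ + 1)
    (hz3 : -(2 * (cfg.hH δ : ℤ) + 1) ≤ tCoord cfg.km (cfg.zm δ) z) (hz4 : tCoord cfg.km (cfg.zm δ) z ≤ 3 * cfg.hH δ + 1)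
    (i : Fin 4) : SideTouch Λ z i := by
  refine Or.inl (H.bulk _ (Or.inl (Or.inl (Or.inl (Or.inr ?_)))))
  refine (H.scale_mem_clearBox_of_near hz1 hz2 hz3 hz4 ?_).1
  rw [abs_dirCoord_le_iff]
  have h : (cornerOff i 0 = 0 ∨ cornerOff i 0 = 1) ∧ (cornerOff i 1 = 0 ∨ cornerOff i 1 = 1) := by fin_cases i <;> simp
  simp only [Complex.sub_re, Complex.sub_im, toComplex_re, toComplex_im, plaqCentre, Pi.add_apply, Int.cast_add]
  constructor
  · rcases h.1 with h0 | h0 <;> rw [h0] <;> norm_num [abs_le]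
  · rcases h.2 with h1 | h1 <;> rw [h1] <;> norm_num [abs_le]

/-- **Plaquettes of the rows `1 … h + 1` over the flat piece are not avoided.** [folklore] -/
theorem not_mem_CsetL_of_rows {z : Site 2} (hz1 : 1 ≤ nCoord cfg.km (cfg.zm δ) z) (hz2 : nCoord cfg.km (cfg.zm δ) z ≤ cfg.hH δ + 1)
    (hz3 : -(2 * (cfg.hH δ : ℤ) + 1) ≤ tCoord cfg.km (cfg.zm δ) z) (hz4 : tCoord cfg.km (cfg.zm δ) z ≤ 3 * cfg.hH δ + 1) :
    z ∉ cfg.CsetL δ Λ μ := by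
  refine H.not_mem_CsetL_of_square
    (S := {x | (|dirCoord cfg.km (x - cfg.pmid)| ≤ 2 * cfg.ℓ ∧ |dirCoord (cfg.km + 1) (x - cfg.pmid)| ≤ 2 * cfg.ℓ) ∧
      0 < dirCoord cfg.km (x - cfg.pmid)}) (fun x hx => ?_) fun w hw => ?_
  · obtain ⟨⟨h1, h2⟩, h3⟩ := hx
    obtain ⟨hm1, hm2⟩ := cfg.clearBox_mid x h1 h2
    refine ⟨?_, fun e => ?_⟩
    · rintro ((h | h) | h)
      · exact hm1 h
      · exact absurd (cfg.dirCoord_eq_zero_of_mem_flat h) h3.ne'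
      · exact hm2 h
    · have := cfg.clearBox_end x h1 h2 e
      linarith [H.μ_le_slack]
  · exact H.scale_mem_clearBox_of_near hz1 hz2 hz3 hz4 ((mem_plaqClosedSq_iff_dirCoord cfg.km z w).1 hw)

/-- **The seed-side rectangle lies in `D`** (it touches a chain window at the far side). [folklore] -/
theorem seedRect_subset_Dreg : ∀ z ∈ H.seedRect, z ∈ cfg.Dreg δ Λ μ := by
  obtain ⟨-, -, hh1⟩ := H.hH_bounds
  have hkpos := H.kH_pos
  -- the inner far plaquette `c' = zm + h e_km` and the far plaquette `zfar = c' + e_km`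
  set c' : Site 2 := cfg.zm δ + (cfg.hH δ : ℤ) • cornerUnit cfg.km + (0 : ℤ) • cornerUnit (cfg.km + 1) with hc'
  obtain ⟨hcn, hct⟩ := cfg.frame_of_add δ (cfg.hH δ : ℤ) 0
  rw [← hc'] at hcn hct
  have hfn : nCoord cfg.km (cfg.zm δ) (c' + cornerUnit cfg.km) = cfg.hH δ + 1 := by
    rw [nCoord_add_cornerUnit, hcn, (nStep_tStep_values cfg.km).1.1]
  have hft : tCoord cfg.km (cfg.zm δ) (c' + cornerUnit cfg.km) = 0 := by
    rw [tCoord_add_cornerUnit, hct, (nStep_tStep_values cfg.km).1.2, add_zero]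
  obtain ⟨j, hj, hjB⟩ := H.far_mem_mB hfn (by rw [hft]; constructor <;> omega)
  -- `c'` is in the window of `cH j`, hence in `D`
  have hc'W : c' ∈ mW (cfg.cH δ j) (cfg.kH δ) := by
    obtain ⟨hb0, hb1⟩ := hjB
    simp only [Pi.add_apply] at hb0 hb1
    have hu : (cornerUnit cfg.km 0 = 0 ∨ cornerUnit cfg.km 0 = 1 ∨ cornerUnit cfg.km 0 = -1) ∧
        (cornerUnit cfg.km 1 = 0 ∨ cornerUnit cfg.km 1 = 1 ∨ cornerUnit cfg.km 1 = -1) := by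
      rcases cornerUnit_apply_cases cfg.km with ⟨h0, h1⟩ | ⟨h0, h1⟩ | ⟨h0, h1⟩ | ⟨h0, h1⟩ <;> simp [h0, h1]
    have hk1 : (1 : ℤ) ≤ cfg.kH δ := by exact_mod_cast hkpos
    simp only [mW, Set.mem_setOf_eq]
    rw [abs_le] at hb0 hb1 ⊢; rw [abs_le]
    constructor
    · rcases hu.1 with h | h | h <;> rw [h] at hb0 <;> constructor <;> linarith
    · rcases hu.2 with h | h | h <;> rw [h] at hb1 <;> constructor <;> linarith
  have hc'D : c' ∈ cfg.Dreg δ Λ μ := (H.hHbig j hj c' hc'W).1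
  have hc'R : c' ∈ H.seedRect := by
    refine ⟨?_, ?_, ?_, ?_⟩ <;> simp only [hcn, hct] <;> omega
  refine frameRect_subset_touchReach H.f₀_not_mem_CsetL cfg.km (cfg.zm δ) (fun f hf j => ?_) (fun f hf => ?_) hc'R hc'D
  · obtain ⟨h1, h2, h3, h4⟩ := hf
    exact H.sideTouch_of_rows h1 (by omega) h3 h4 j
  · obtain ⟨h1, h2, h3, h4⟩ := hf
    exact H.not_mem_CsetL_of_rows h1 (by omega) h3 h4

/-- **`hMidBox`**: the half-boxes over the flat piece lie in `D` and touch `Λ` across every side. [folklore] -/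
theorem hMidBox : ∀ t : ℕ, t ≤ cfg.hH δ → ∀ z ∈ flatHalfBox cfg.km (cfg.zmt δ t) (cfg.hH δ) (2 * cfg.hH δ + 1),
    z ∈ cfg.Dreg δ Λ μ ∧ ∀ j : Fin 4, SideTouch Λ z j := by
  intro t ht z hz
  obtain ⟨h1, h2, h3⟩ := hz
  obtain ⟨cn, ct⟩ := frame_change_base cfg.km (cfg.zm δ) (cfg.zmt δ t) z
  obtain ⟨zn, zt⟩ := cfg.frame_zmt δ t
  rw [cn, zn, sub_zero] at h1 h2
  rw [ct, zt, abs_le] at h3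
  have ht' : (t : ℤ) ≤ cfg.hH δ := by exact_mod_cast ht
  refine ⟨H.seedRect_subset_Dreg z ⟨h1, by exact_mod_cast h2, by push_cast at h3 ⊢; omega, by push_cast at h3 ⊢; omega⟩,
    fun j => H.sideTouch_of_rows h1 (by omega) (by push_cast at h3 ⊢; omega) (by push_cast at h3 ⊢; omega) j⟩

/-- **`hFlatRun`**: the flat-piece plaquettes are `Flat`, off `D`, and their seed-side neighbours
are in `D` across a touching side. [folklore] -/
theorem hFlatRun : ∀ t : ℕ, t ≤ cfg.hH δ → H.Flat (runPt (cfg.zm δ) (cfg.km + 1) t) ∧ runPt (cfg.zm δ) (cfg.km + 1) t ∉ cfg.Dreg δ Λ μ ∧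
    runPt (cfg.zm δ) (cfg.km + 1) t + cornerUnit cfg.km ∈ cfg.Dreg δ Λ μ ∧
    SideTouch Λ (runPt (cfg.zm δ) (cfg.km + 1) t + cornerUnit cfg.km) (cfg.km + 3) := by
  intro t ht
  have hzmt : runPt (cfg.zm δ) (cfg.km + 1) t = cfg.zmt δ t := rfl
  rw [hzmt]
  obtain ⟨zn, zt⟩ := cfg.frame_zmt δ t
  have hn : nCoord cfg.km (cfg.zm δ) (cfg.zmt δ t + cornerUnit cfg.km) = 1 := by
    rw [nCoord_add_cornerUnit, zn, (nStep_tStep_values cfg.km).1.1, zero_add]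
  have htc : tCoord cfg.km (cfg.zm δ) (cfg.zmt δ t + cornerUnit cfg.km) = t := by
    rw [tCoord_add_cornerUnit, zt, (nStep_tStep_values cfg.km).1.2, add_zero]
  obtain ⟨-, -, hh1⟩ := H.hH_bounds
  have ht' : (t : ℤ) ≤ cfg.hH δ := by exact_mod_cast ht
  refine ⟨⟨t, ht, rfl⟩, fun hD => H.not_mem_CsetL_of_mem_Dreg hD (H.zmt_mem_CsetL ht), ?_, ?_⟩
  · exact H.seedRect_subset_Dreg _ ⟨by omega, by rw [hn]; exact_mod_cast hh1, by omega, by omega⟩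
  · exact H.sideTouch_of_rows (by omega) (by rw [hn]; omega) (by omega) (by omega) _

end ScaleHyp

end KCSignConfig

end Literature.Probability.LatticeModels
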